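import Summits.QuantumFields.YangMills.Theorems.UnitScaleTiltProp7SectET3WilsonHessianT3
import Mathlib.Analysis.Calculus.FDeriv.Symmetric
import Mathlib.Analysis.SpecialFunctions.Exponential
import HarnessLib

/-!
# Route `UnitScaleTilt`, crux «MinimiserStabilityRegPr» (stmt-QuantumFields-19200, stub EX) ∕ (O″χ) B0 (stmt-QuantumFields-20520), node N06(d = 3), route (α) —
# LAYER 0, ROWS OF BRICK L0b (def-free sibling of `UnitScaleTiltProp7SectET3WilsonHessianT3`), PART 1: **THE COMPLEXIFIED WILSON ACTION ALONG THE CHART IS SMOOTH, AND THE QUADRATIC TERM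
# OF (3.7) IS A SYMMETRIC BILINEAR FORM** — `ContDiff ℂ ω (actionRe ∘ chartU U₀)` (polynomial in `e^{±X(b)}`), hence Schwarz symmetry `hessFormRe U₀ A B = hessFormRe U₀ B A` of the second
# derivative that DEFINES print's `Δ^η(U₀)` ([Balaban1985BackgroundPropagators] (3.7)∕(3.12) p.391–392: «it is a hermitian operator given by the quadratic form (3.10)» — first half of the
# self-adjointness row; the reality half `conj (hessFormRe A B) = hessFormRe Aᴴ Bᴴ` at unitary `U₀` is part 2)

Cell `ym-inputs` (desk `pub/ym-inputs`, INPUT-LIST.md v6 §4 row p01; memo `pub/ym-inputs/DEFINER-MEMO-T3.md` §2 L0b).  THEOREMS ONLY (0 `def`, 0 `sorry`); `--supports stmt-QuantumFields-20520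
--as helper`; count-neutral.  YM₃ on T³ is ladder rung R3, NOT the Clay problem; nothing here is a claim about a stub, a crux, d = 4 or the mass gap.

WHAT IS PROVED (member `F`, `K`, background `U₀`): `val_chartU` ∕ `val_chartU_inv` (the matrices `e^{X(b)}U₀(b)` and `U₀(b)⁻¹e^{−X(b)}`); `contDiff_val_chartU`, `contDiff_val_chartU_inv` (smooth in `X`:
Mathlib's `NormedSpace.exp_analytic` + the evaluation CLM); ★`contDiff_val_holT_chartU` (every parallel transport `W(Γ)` of the chart configuration is smooth in `X` — induction on the word);
`contDiff_val_plaqU_chartU`, `contDiff_val_plaqU_chartU_inv` (`W(∂p)^{±1}`); ★★`contDiff_actionRe_chartU` (`ContDiff ℂ ω (X ↦ actionRe (chartU U₀ X))`); ★★`hessFormRe_symm` (Schwarz symmetry of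
the defining bilinear form, `ContDiffAt.isSymmSndFDerivAt`).
HONEST SCOPE.  Calculus bookkeeping about brick L0b's definitions; no estimate; nothing of print asserted.

References: T. Bałaban, CMP **99** (1985) 389–434 [Balaban1985BackgroundPropagators] ((3.6)–(3.7) p.391, (3.10)–(3.12) p.392).
-/

set_option autoImplicit false

noncomputable section

open scoped InnerProductSpace ComplexConjugate Matrix.Norms.L2Operator BigOperators

namespace Summit.QuantumFields.YangMills.Theorems.Prop7SectET3WilsonHessian

open Literature.MathematicalPhysics.QuantumFieldTheory.Balaban1983to89
open Literature.MathematicalPhysics.QuantumFieldTheory.Balaban1983to89.T3ContinuumYM3Torus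
open NormedSpace (exp exp_analytic)
open T3SectALandauChart (bgUnits)
open B10Eq27TorusAxialLog (holT holT_nil holT_cons_true holT_cons_false)
open B7Prop1Explicit (expUnit val_expUnit val_inv_expUnit plaqWord Letter)

variable {F : T3Family} {K : ℕ}

/-! ## §1 The chart configuration bondwise, and its smoothness in the exponent -/

/-- `(e^{X}·U₀)(b) = e^{X(b)}·U₀(b)` as a matrix. [cite: Balaban1985BackgroundPropagators, (3.6) p.391] -/
theorem val_chartU (U₀ : GaugeField (F.P K) 0 (Matrix.specialUnitaryGroup (Fin 2) ℂ)) (X : PBond (F.P K) 0 → Matrix (Fin 2) (Fin 2) ℂ) (b : PBond (F.P K) 0) :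
    ((chartU F K U₀ X b : (Matrix (Fin 2) (Fin 2) ℂ)ˣ) : Matrix (Fin 2) (Fin 2) ℂ) = exp (X b) * ((bgUnits F K U₀ b : (Matrix (Fin 2) (Fin 2) ℂ)ˣ) : Matrix (Fin 2) (Fin 2) ℂ) := by
  simp [chartU]

/-- `(e^{X}·U₀)(b)⁻¹ = U₀(b)⁻¹·e^{−X(b)}` as a matrix. [cite: Balaban1985BackgroundPropagators, (3.5)–(3.6) p.391] -/
theorem val_chartU_inv (U₀ : GaugeField (F.P K) 0 (Matrix.specialUnitaryGroup (Fin 2) ℂ)) (X : PBond (F.P K) 0 → Matrix (Fin 2) (Fin 2) ℂ) (b : PBond (F.P K) 0) :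
    (((chartU F K U₀ X b)⁻¹ : (Matrix (Fin 2) (Fin 2) ℂ)ˣ) : Matrix (Fin 2) (Fin 2) ℂ) =
      (((bgUnits F K U₀ b)⁻¹ : (Matrix (Fin 2) (Fin 2) ℂ)ˣ) : Matrix (Fin 2) (Fin 2) ℂ) * exp (-X b) := by
  simp [chartU, mul_inv_rev]

/-- `X ↦ e^{X(b)}·U₀(b)` is smooth (analytic exponential ∘ evaluation). [folklore] -/
theorem contDiff_val_chartU (U₀ : GaugeField (F.P K) 0 (Matrix.specialUnitaryGroup (Fin 2) ℂ)) (b : PBond (F.P K) 0) :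
    ContDiff ℂ ⊤ (fun X : PBond (F.P K) 0 → Matrix (Fin 2) (Fin 2) ℂ => ((chartU F K U₀ X b : (Matrix (Fin 2) (Fin 2) ℂ)ˣ) : Matrix (Fin 2) (Fin 2) ℂ)) := by
  simp_rw [val_chartU]
  have hexp : ContDiff ℂ ⊤ (fun Y : Matrix (Fin 2) (Fin 2) ℂ => exp Y) :=
    contDiff_iff_contDiffAt.2 fun Y => (exp_analytic Y).contDiffAt
  have hev : ContDiff ℂ ⊤ (fun X : PBond (F.P K) 0 → Matrix (Fin 2) (Fin 2) ℂ => X b) := contDiff_apply ℂ (Matrix (Fin 2) (Fin 2) ℂ) b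
  exact (hexp.comp hev).mul contDiff_const

/-- `X ↦ U₀(b)⁻¹·e^{−X(b)}` is smooth. [folklore] -/
theorem contDiff_val_chartU_inv (U₀ : GaugeField (F.P K) 0 (Matrix.specialUnitaryGroup (Fin 2) ℂ)) (b : PBond (F.P K) 0) :
    ContDiff ℂ ⊤ (fun X : PBond (F.P K) 0 → Matrix (Fin 2) (Fin 2) ℂ => (((chartU F K U₀ X b)⁻¹ : (Matrix (Fin 2) (Fin 2) ℂ)ˣ) : Matrix (Fin 2) (Fin 2) ℂ)) := by
  simp_rw [val_chartU_inv]
  have hexp : ContDiff ℂ ⊤ (fun Y : Matrix (Fin 2) (Fin 2) ℂ => exp Y) :=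
    contDiff_iff_contDiffAt.2 fun Y => (exp_analytic Y).contDiffAt
  have hev : ContDiff ℂ ⊤ (fun X : PBond (F.P K) 0 → Matrix (Fin 2) (Fin 2) ℂ => -X b) := (contDiff_apply ℂ (Matrix (Fin 2) (Fin 2) ℂ) b).neg
  exact contDiff_const.mul (hexp.comp hev)

/-- ★ **EVERY PARALLEL TRANSPORT OF THE CHART CONFIGURATION IS SMOOTH IN THE EXPONENT**: `X ↦ (e^{X}U₀)(Γ)` for every word `Γ` (induction on the word; the letters contribute
`e^{X(b)}U₀(b)` or its inverse). [cite: Balaban1985Averaging, (9) p.19] -/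
theorem contDiff_val_holT_chartU (U₀ : GaugeField (F.P K) 0 (Matrix.specialUnitaryGroup (Fin 2) ℂ)) (w : List (Letter (F.P K).d)) :
    ∀ x : Site (F.P K) 0, ContDiff ℂ ⊤ (fun X : PBond (F.P K) 0 → Matrix (Fin 2) (Fin 2) ℂ =>
      ((holT (chartU F K U₀ X) x w : (Matrix (Fin 2) (Fin 2) ℂ)ˣ) : Matrix (Fin 2) (Fin 2) ℂ)) := by
  induction w with
  | nil => intro x; simp only [holT_nil, Units.val_one]; exact contDiff_const
  | cons l w ih =>
    intro x
    obtain ⟨μ, s⟩ := l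
    cases s with
    | true =>
      simp only [holT_cons_true, Units.val_mul]
      exact (contDiff_val_chartU U₀ _).mul (ih _)
    | false =>
      simp only [holT_cons_false, Units.val_mul]
      exact (contDiff_val_chartU_inv U₀ _).mul (ih _)

/-- The plaquette variable of the chart configuration is smooth in the exponent. [cite: Balaban1985BackgroundPropagators, (3.6) p.391] -/
theorem contDiff_val_plaqU_chartU (U₀ : GaugeField (F.P K) 0 (Matrix.specialUnitaryGroup (Fin 2) ℂ)) (p : Plaq (F.P K) 0) :
    ContDiff ℂ ⊤ (fun X : PBond (F.P K) 0 → Matrix (Fin 2) (Fin 2) ℂ => ((plaqU F K (chartU F K U₀ X) p : (Matrix (Fin 2) (Fin 2) ℂ)ˣ) : Matrix (Fin 2) (Fin 2) ℂ)) :=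
  contDiff_val_holT_chartU U₀ _ _

/-- … and so is its inverse (smoothness of `Ring.inverse` at units, Mathlib's `contDiffAt_ringInverse`). [folklore] -/
theorem contDiff_val_plaqU_chartU_inv (U₀ : GaugeField (F.P K) 0 (Matrix.specialUnitaryGroup (Fin 2) ℂ)) (p : Plaq (F.P K) 0) :
    ContDiff ℂ ⊤ (fun X : PBond (F.P K) 0 → Matrix (Fin 2) (Fin 2) ℂ => (((plaqU F K (chartU F K U₀ X) p)⁻¹ : (Matrix (Fin 2) (Fin 2) ℂ)ˣ) : Matrix (Fin 2) (Fin 2) ℂ)) := by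
  have h : (fun X : PBond (F.P K) 0 → Matrix (Fin 2) (Fin 2) ℂ => (((plaqU F K (chartU F K U₀ X) p)⁻¹ : (Matrix (Fin 2) (Fin 2) ℂ)ˣ) : Matrix (Fin 2) (Fin 2) ℂ)) =
      fun X => Ring.inverse ((plaqU F K (chartU F K U₀ X) p : (Matrix (Fin 2) (Fin 2) ℂ)ˣ) : Matrix (Fin 2) (Fin 2) ℂ) := by
    funext X; rw [Ring.inverse_unit]
  rw [h]
  refine contDiff_iff_contDiffAt.2 fun X => ?_
  have h1 : ContDiffAt ℂ ⊤ (Ring.inverse : Matrix (Fin 2) (Fin 2) ℂ → Matrix (Fin 2) (Fin 2) ℂ)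
      ((plaqU F K (chartU F K U₀ X) p : (Matrix (Fin 2) (Fin 2) ℂ)ˣ) : Matrix (Fin 2) (Fin 2) ℂ) := contDiffAt_ringInverse ℂ _
  exact h1.comp X (contDiff_val_plaqU_chartU U₀ p).contDiffAt

/-! ## §2 Smoothness of the complexified action along the chart, and Schwarz symmetry of the Hessian form -/

/-- ★★ **THE COMPLEXIFIED WILSON ACTION IS SMOOTH ALONG THE CHART**: `ContDiff ℂ ω (X ↦ actionRe (e^{X}U₀))` (a finite sum of traces of `W(∂p)^{±1}`).
[cite: Balaban1985BackgroundPropagators, (3.7) p.391, (3.12) p.392] -/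
theorem contDiff_actionRe_chartU (U₀ : GaugeField (F.P K) 0 (Matrix.specialUnitaryGroup (Fin 2) ℂ)) :
    ContDiff ℂ ⊤ (fun X : PBond (F.P K) 0 → Matrix (Fin 2) (Fin 2) ℂ => actionRe F K (chartU F K U₀ X)) := by
  have htr : ContDiff ℂ ⊤ (fun M : Matrix (Fin 2) (Fin 2) ℂ => Matrix.trace M) :=
    (LinearMap.toContinuousLinearMap (Matrix.traceLinearMap (Fin 2) ℂ ℂ)).contDiff
  simp only [actionRe_def]
  refine ContDiff.sum fun p _ => contDiff_const.sub (contDiff_const.mul ?_)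
  exact (htr.comp (contDiff_val_plaqU_chartU U₀ p)).add (htr.comp (contDiff_val_plaqU_chartU_inv U₀ p))

/-- ★★ **SCHWARZ SYMMETRY OF THE DEFINING FORM OF `Δ^η(U₀)`**: `hessFormRe U₀ A B = hessFormRe U₀ B A` — the second derivative of a `C²` function is symmetric (`ContDiffAt.isSymmSndFDerivAt`); the
«symmetric» half of print's «hermitian operator» (the reality half is part 2). [cite: Balaban1985BackgroundPropagators, (3.10)–(3.12) p.392] -/
theorem hessFormRe_symm (U₀ : GaugeField (F.P K) 0 (Matrix.specialUnitaryGroup (Fin 2) ℂ)) (A B : PBond (F.P K) 0 → Matrix (Fin 2) (Fin 2) ℂ) :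
    hessFormRe F K U₀ A B = hessFormRe F K U₀ B A :=
  ((contDiff_actionRe_chartU U₀).contDiffAt.isSymmSndFDerivAt (n := ⊤) (by simp)) A B

end Summit.QuantumFields.YangMills.Theorems.Prop7SectET3WilsonHessian

end
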